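import Summits.QuantumFields.BalabanUV.Beta.GAN24.WardResidualLabelSums
import Summits.QuantumFields.BalabanUV.Beta.WardLocusResidualClass
import Summits.QuantumFields.BalabanUV.Beta.SpineRecursivePureParity
import Summits.QuantumFields.BalabanUV.Beta.GAN24.DMBondCharges
import Summits.QuantumFields.BalabanUV.Beta.SymSliceProjectorDiagComm

/-!
# `BalabanUV.Beta.GAN24.WardResidualRotatedVertex` — binder row G-an2-4 ∕ (CONV-C), CT-W route «WC-TL» → «QR-LL», the OWNER gan24-p1 g26's CHARGE AUDIT
# (W2 ∕ W10, journal l.40158 ∕ l.40372), σ-piece (α): **THE ROTATED-VERTEX LETTER `½ • dM([G_{j+1}, X_y]) S_{j+1} M1_{j+1}` IN CLOSED FORM AND ITS LIVE CHARGE**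
# (= crux-ideation lens 1's `WARD8-GAN24.md` (4.9), idea-1 g35 — typed; road-P2 chair `b2b-balaban-gan24-p2`, gen 38, first refusal on the (α)∕(β) `dM` read-out exercised)

NOT IN PRINT; OUR BOOKKEEPING ([folklore] kernel algebra + one Fubini BY NAME over an2's `colH ∕ colM ∕ vertexOfK ∕ vertexOfM ∕ dM`, an1's
`DiagonalContact.conjV_diagK_apply`, `WardLocusCubic.mmSym_blockGen_inl`, `SymSliceProjectorDiagComm.sum_box_legInd_inl`, `SpineRecursivePureParity.parityOdd_dM_SpureRecAt_M1At`
and leaf-06's `KernelLegCharges.hasSum_prod_wsum`; 0 `def`, 0 cited fact, 0 `def … : Prop`, 0 sorry).  HONEST FRAMING (cell contract, verbatim): «discharging `BetaPertH` makes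
Bałaban's UV stability UNCONDITIONAL — a real constructive-QFT result; it is NOT the continuum limit and NOT the Clay problem.»  HONEST DEPENDENCY (verbatim): «continuum YM on
T⁴ ⇐ BetaPertH ∧ nine spine estimates (0/9 proved); BetaPertH ⇐ (D1) ∧ (D4) ∧ CAP+tail; G-an2-4 gates asym, D1 and NE2/3/4.»

WHERE (α) SITS.  In the S-step form of the Ward-locus residual tower (`WardResidualSRecursion.divW_WrecAt_succ_vertexForm`) the level-(j+1) first-order data are
`Ψ′ y ν y′ = vertexOfM G_{j+1} Lc (RM y) ν y′ + ½ • (dM (conjV G_{j+1} X_y) Lc S_{j+1} M1_{j+1} ν y′ − (scale)⁻¹ • gauge-read)`, `X_y = diagK (½ • Σ_{v∈box} legInd ρ (Lc•y + v))`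
(the block rotation generator), `G_{j+1} = coDressKBmAt ρ Lc (KInvStep Lc (j+1))`, `S_{j+1} = SpureRecAt … (j+1)`, `M1_{j+1} = M1At … (j+1)`; the σ-letter of the next S-step is their
`G_{j+1}`-sandwich.  The OWNER's audit asks, per piece, an identity for the live charge `Σ_{x,z} P(ν,y′)(x,z)(a,b)`.  This file treats (α) = the middle piece.

WHAT (generic `d`; §1 for ANY kernel `K` and symbol `g`, §3 for ANY `G`, `S`, `M`).
* §1 `colH_conjV_diagK`, `colM_conjV_diagK`, **`vertexOfK_conjV_diagK`**, `vertexOfM_conjV_diagK`, **`dM_conjV_diagK`** (hypothesis-free, termwise): a `dM`-read sees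
  the commutator `[K, diagK g]` ONLY through its one coarse column `(μ, N•y)`; so the `dM`-read of `[K, diagK g]` IS the `dM`-read of `K` on REWEIGHTED tables,
  weight = «slot value of `g` minus table-position value of `g`».
* §2 the comb symbol `ξ • Σ_{v∈box} legInd ρ (Lc•y + v)` (in-block root): on a field leg it is `ξ·𝟙[blk Lc u = y]` (`blockGen_inl`), on a multiplier leg at a coarse point
  `ξ·𝟙[w = y]` (`blockGen_zsmul_inr`).
* §3 **`rotatedVertex_eq`** — (α) IN CLOSED FORM, idea-1's «slot in `y` minus table position in `y`»:
  `½ • dM (conjV G X_y) Lc S M ν y′ = ½ • dM G Lc (fun κ u ↦ (½𝟙[y′ = y] − ½𝟙[blk Lc u = y]) • S κ u) (fun ρ′ w ↦ (½𝟙[y′ = y] − ½𝟙[w = y]) • M ρ′ w) ν y′`;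
  **`trK_rotatedVertex_comb`**: at the comb tables (α) is row-PARITY-ODD for ANY symbol (the OWNER's W9 (b): σ-pieces are `dM`-reads and inherit the stencils'
  sgn-antisymmetry whatever the symmetry of `G`).
* §4 LIVE CHARGES (value forms, `HasSum` on kernel-leg pairs): `hasSum_prod_vertexOfK` (the VALUE form of leaf-06's `DMBondCharges.hasSum_vertexOfK_legs`),
  `hasSum_prod_vertexOfM` (value form without block covariance), `hasSum_prod_dM`; `hasSum_prod_swap_of_parityOdd` ∕ `eq_zero_of_parityOdd_diag` (a parity-odd kernel
  has a sgn-ANTISYMMETRIC pair-charge matrix, ZERO in every diagonal channel); at the comb **`hasSum_prod_rotatedVertex_comb`** (the live charge of (α) at slot `(ν,y′)`,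
  channel `(a,b)` = `½·[Σ_κ Σ'_u colH G_{j+1} ν y′ κ u·(½𝟙[y′=y] − ½𝟙_{B(y)}(u))·Z_S(κ,u)(a,b) + Σ_ρ′ Σ'_w colM G_{j+1} ν y′ ρ′ w·(½𝟙[y′=y] − ½𝟙[w=y])·Z_{M1}(ρ′,w)(a,b)]`,
  `Z_X(·)(a,b) := Σ'_{(x,z)} X · x z a b`), **`hasSum_prod_rotatedVertex_comb_swap ∕ _diag`** (W10's wanted lemma: antisymmetric charge matrix, zero diagonal channels,
  POINTWISE in the slot — no symmetry of `G_{j+1}` used) and `hasSum_prod_rotatedVertex_comb_zero` (branch-(S) test per channel: charge-free letters ⇒ charge-free (α)).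
READING (docstring level; no value of Bałaban's tables asserted): (α)'s audit numbers are the first-order letters' OWN channel charges `Z_S(κ,u)` (for the comb S-slot a
two-face sum of the previous member's vertex, `CubicPushFaceCharge.hasSum_prod_SpureRecAt_succ_inl_inl` — DISPLAYED there; its vanishing, (S3c) for the comb S-slot, holds on
the engine at j = 0, 1 (E15 PART C, leaf-04 g61 R-1) and is NOT asserted here) and `Z_{M1}(ρ′,w)`, weighted by ONE coarse column
of `G_{j+1}` against the profile «`δ_{y′y} − 𝟙_{B(y)}`»; the kernel-level (anti)symmetry of `[G, X_y]` never enters.  Discharges NOTHING of (Q-R) ∕ (LT) ∕ (Q-L) ∕ (C) ∕ the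
audit's VALUES ∕ «T2Shape» ∕ «T2Drift» ∕ (hW, hWall); NEVER «G-an2-4 closed» as (CONV-C); NOT D1, NOT BetaPertH, NOT continuum, NOT Clay.  2026-08-22; no existing file touched.
-/

noncomputable section

open Finset
open scoped BigOperators
open Literature.MathematicalPhysics.QuantumFieldTheory
open Literature.MathematicalPhysics.QuantumFieldTheory.Balaban1983to89
open Literature.MathematicalPhysics.QuantumFieldTheory.Balaban1983to89.Beta
open B12Sec2to5 (l1)
open ExpKernelCalculus (Site MKer BiLoc Decays VertexFamily comp)
open AffineAveraging (box toSite)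
open AveragingContours (blk)
open OneStepResolventKernel (Fib LocStencil wsum)
open OneStepKernelFamily (KInvStep colH vertexOfK abs_colH_le)
open SecondOrderResponse (colM vertexOfM dM dM_apply abs_colM_le)
open InterLevelTransport (cwsum cwsum_apply)
open Summit.QuantumFields.BalabanUV.Beta.TameKernelCalculus (trK trK_apply)
open Summit.QuantumFields.BalabanUV.Beta.BorderedHessian (diagK sgnK sgnF sgnK_apply conjV_diagK_apply)
open Summit.QuantumFields.BalabanUV.Beta.ChartConjugation (conjV)
open Summit.QuantumFields.BalabanUV.Beta.AveragingWardRootedStencils (legInd)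
open Summit.QuantumFields.BalabanUV.Beta.AxialDressingRooted (coDressKBmAt decays_coDressKBmAt_KInvStep)
open Summit.QuantumFields.BalabanUV.Beta.SpineRooted (SpureRecAt M1At locStencil_SpureRecAt vertexFamily_M1At)
open Summit.QuantumFields.BalabanUV.Beta.SpineRecursiveParity (parityOdd_smul)
open Summit.QuantumFields.BalabanUV.Beta.SpineRecursivePureParity (parityOdd_dM_SpureRecAt_M1At)
open Summit.QuantumFields.BalabanUV.Beta.WardLocusCubic (mmSym mmSym_blockGen_inl)
open Summit.QuantumFields.BalabanUV.Beta.WardLocusResidualClass (abs_blockGen_le)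
open Summit.QuantumFields.BalabanUV.Beta.SymSliceProjectorDiagComm (sum_box_legInd_inl)
open Summit.QuantumFields.BalabanUV.Beta.GAN24.KernelLegCharges (hasSum_prod_wsum)
open Summit.QuantumFields.BalabanUV.Beta.GAN24.WardResidualLabelSums (decays_conjV_diagK)

namespace Summit.QuantumFields.BalabanUV.Beta.GAN24.WardResidualRotatedVertex

variable {d : ℕ}

/-! ## §1 A `dM`-read sees the commutator `[K, diagK g]` through ONE coarse column: reweighted tables -/

section Generic

variable {N : ℕ}

/-- [folklore] The field rows of the `(μ, N•y)`-column of the commutator `[K, diagK g]`: the column of `K` times «`g` at the slot minus `g` at the row leg». -/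
theorem colH_conjV_diagK (K : MKer (d + 1) (Fib d)) (g : (Fin (d + 1) → ℤ) → Fib d → ℝ) (μ : Fin (d + 1)) (y : Fin (d + 1) → ℤ)
    (κ : Fin (d + 1)) (u : Fin (d + 1) → ℤ) :
    colH (conjV K (diagK g)) N μ y κ u = colH K N μ y κ u * (g ((N : ℤ) • y) (Sum.inr μ) - g u (Sum.inl κ)) := by
  simp only [colH, conjV_diagK_apply]

/-- [folklore] The multiplier rows of the `(μ, N•y)`-column of the commutator `[K, diagK g]`: the column of `K` times «`g` at the slot minus `g` at the row leg». -/
theorem colM_conjV_diagK (K : MKer (d + 1) (Fib d)) (g : (Fin (d + 1) → ℤ) → Fib d → ℝ) (μ : Fin (d + 1)) (y : Fin (d + 1) → ℤ)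
    (ρ : Fin (d + 1)) (w : Fin (d + 1) → ℤ) :
    colM (conjV K (diagK g)) N μ y ρ w = colM K N μ y ρ w * (g ((N : ℤ) • y) (Sum.inr μ) - g ((N : ℤ) • w) (Sum.inr ρ)) := by
  simp only [colM, conjV_diagK_apply]

/-- [folklore] **THE CHAIN-RULE VERTEX THROUGH A COMMUTATOR IS THE VERTEX THROUGH THE KERNEL ON A REWEIGHTED TABLE**:
`vertexOfK (conjV K (diagK g)) N S μ y = vertexOfK K N (fun κ u ↦ (g (N•y) (inr μ) − g u (inl κ)) • S κ u) μ y` (termwise; no summability needed). -/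
theorem vertexOfK_conjV_diagK (K : MKer (d + 1) (Fib d)) (g : (Fin (d + 1) → ℤ) → Fib d → ℝ)
    (S : Fin (d + 1) → (Fin (d + 1) → ℤ) → MKer (d + 1) (Fib d)) (μ : Fin (d + 1)) (y : Fin (d + 1) → ℤ) :
    vertexOfK (conjV K (diagK g)) N S μ y = vertexOfK K N (fun κ u => (g ((N : ℤ) • y) (Sum.inr μ) - g u (Sum.inl κ)) • S κ u) μ y := by
  funext x z a b
  simp only [vertexOfK, wsum, colH_conjV_diagK, Pi.smul_apply, smul_eq_mul]
  refine Finset.sum_congr rfl fun κ _ => tsum_congr fun u => ?_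
  ring

/-- [folklore] **THE MULTIPLIER VERTEX THROUGH A COMMUTATOR IS THE VERTEX THROUGH THE KERNEL ON A REWEIGHTED TABLE**:
`vertexOfM (conjV K (diagK g)) N M μ y = vertexOfM K N (fun ρ w ↦ (g (N•y) (inr μ) − g (N•w) (inr ρ)) • M ρ w) μ y`. -/
theorem vertexOfM_conjV_diagK [NeZero N] (K : MKer (d + 1) (Fib d)) (g : (Fin (d + 1) → ℤ) → Fib d → ℝ)
    (M : Fin (d + 1) → (Fin (d + 1) → ℤ) → MKer (d + 1) (Fib d)) (μ : Fin (d + 1)) (y : Fin (d + 1) → ℤ) :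
    vertexOfM (conjV K (diagK g)) N M μ y =
      vertexOfM K N (fun ρ w => (g ((N : ℤ) • y) (Sum.inr μ) - g ((N : ℤ) • w) (Sum.inr ρ)) • M ρ w) μ y := by
  funext x z a b
  simp only [vertexOfM, cwsum_apply, colM_conjV_diagK, Pi.smul_apply, smul_eq_mul]
  refine Finset.sum_congr rfl fun ρ _ => tsum_congr fun w => ?_
  ring

/-- [folklore] **an2's `dM` THROUGH A COMMUTATOR = `dM` THROUGH THE KERNEL ON REWEIGHTED TABLES** («slot value of `g` minus table-position value of `g`»):
`dM (conjV K (diagK g)) N S M μ y = dM K N S♭ M♭ μ y`, `S♭ κ u = (g (N•y) (inr μ) − g u (inl κ)) • S κ u`, `M♭ ρ w = (g (N•y) (inr μ) − g (N•w) (inr ρ)) • M ρ w`.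
The kernel-level (anti)symmetry of the commutator is invisible to a `dM`-read. -/
theorem dM_conjV_diagK [NeZero N] (K : MKer (d + 1) (Fib d)) (g : (Fin (d + 1) → ℤ) → Fib d → ℝ)
    (S M : Fin (d + 1) → (Fin (d + 1) → ℤ) → MKer (d + 1) (Fib d)) (μ : Fin (d + 1)) (y : Fin (d + 1) → ℤ) :
    dM (conjV K (diagK g)) N S M μ y =
      dM K N (fun κ u => (g ((N : ℤ) • y) (Sum.inr μ) - g u (Sum.inl κ)) • S κ u)
        (fun ρ w => (g ((N : ℤ) • y) (Sum.inr μ) - g ((N : ℤ) • w) (Sum.inr ρ)) • M ρ w) μ y := by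
  unfold SecondOrderResponse.dM
  rw [vertexOfK_conjV_diagK, vertexOfM_conjV_diagK]

end Generic

/-! ## §2 The comb block generator's symbol: field legs see the block indicator, multiplier legs at coarse points see the one site `y` -/

section BlockGen

variable {Lc : ℕ}

/-- [folklore] On a FIELD leg the block generator `ξ • Σ_{v∈box} legInd ρ (Lc•y + v)` is `ξ·𝟙[blk Lc u = y]` (`SymSliceProjectorDiagComm.sum_box_legInd_inl`). -/
theorem blockGen_inl (hLc : 1 ≤ Lc) (ρ : Fin (d + 1) → ℤ) (ξ : ℝ) (y u : Fin (d + 1) → ℤ) (κ : Fin (d + 1)) :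
    (ξ • ∑ v ∈ box (d + 1) Lc, legInd ρ ((Lc : ℤ) • y + toSite v)) u (Sum.inl κ) = if blk Lc u = y then ξ else 0 := by
  rw [Pi.smul_apply, Pi.smul_apply, Finset.sum_apply, Finset.sum_apply, smul_eq_mul, sum_box_legInd_inl hLc ρ y u κ]
  split_ifs <;> simp

/-- [folklore] On a MULTIPLIER leg at a coarse point the block generator with an in-block root is `ξ·𝟙[w = y]` (`WardLocusCubic.mmSym_blockGen_inl`). -/
theorem blockGen_zsmul_inr {r : Fin (d + 1) → ℕ} (hr : r ∈ box (d + 1) Lc) (ξ : ℝ) (y w : Fin (d + 1) → ℤ) (ρ' : Fin (d + 1)) :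
    (ξ • ∑ v ∈ box (d + 1) Lc, legInd (toSite r) ((Lc : ℤ) • y + toSite v)) ((Lc : ℤ) • w) (Sum.inr ρ') = if w = y then ξ else 0 := by
  have h : mmSym Lc (ξ • ∑ v ∈ box (d + 1) Lc, legInd (toSite r) ((Lc : ℤ) • y + toSite v)) w (Sum.inl ρ') = ξ * (if w = y then 1 else 0) :=
    mmSym_blockGen_inl hr ξ y w ρ'
  rw [show mmSym Lc (ξ • ∑ v ∈ box (d + 1) Lc, legInd (toSite r) ((Lc : ℤ) • y + toSite v)) w (Sum.inl ρ') =
      (ξ • ∑ v ∈ box (d + 1) Lc, legInd (toSite r) ((Lc : ℤ) • y + toSite v)) ((Lc : ℤ) • w) (Sum.inr ρ') from rfl] at h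
  rw [h]
  split_ifs <;> simp

end BlockGen

/-! ## §3 (α) in closed form: «slot in `y` minus table position in `y`» -/

section ClosedForm

variable {Lc : ℕ} [NeZero Lc]

/-- NOT IN PRINT; OUR BOOKKEEPING (= idea-1 g35's `WARD8-GAN24.md` (4.9), typed for ANY kernel `G` and ANY tables `S`, `M`).  **THE ROTATED-VERTEX LETTER (α) IN CLOSED FORM.**
With the block rotation generator `X_y = diagK (½ • Σ_{v∈box} legInd ρ (Lc•y + v))` of an in-block root `ρ = toSite r`:
`½ • dM (conjV G X_y) Lc S M ν y′ = ½ • dM G Lc (fun κ u ↦ (½𝟙[y′ = y] − ½𝟙[blk Lc u = y]) • S κ u) (fun ρ′ w ↦ (½𝟙[y′ = y] − ½𝟙[w = y]) • M ρ′ w) ν y′`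
— at the DIAGONAL slot `y′ = y` half the out-of-block legs of `S` and half the `w ≠ y` rows of `M`; OFF it, minus half the in-block legs ∕ the `w = y` row.  No decay, no locality,
no symmetry of `G` is used: (α) is a `dM`-read. -/
theorem rotatedVertex_eq (hLc : 1 ≤ Lc) {r : Fin (d + 1) → ℕ} (hr : r ∈ box (d + 1) Lc) (G : MKer (d + 1) (Fib d))
    (S M : Fin (d + 1) → (Fin (d + 1) → ℤ) → MKer (d + 1) (Fib d)) (y : Fin (d + 1) → ℤ) (ν : Fin (d + 1)) (y' : Fin (d + 1) → ℤ) :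
    (1 / 2 : ℝ) • dM (conjV G (diagK (((1 : ℝ) / 2) • ∑ v ∈ box (d + 1) Lc, legInd (toSite r) ((Lc : ℤ) • y + toSite v)))) Lc S M ν y' =
      (1 / 2 : ℝ) • dM G Lc
        (fun κ u => ((if y' = y then (1 / 2 : ℝ) else 0) - (if blk Lc u = y then (1 / 2 : ℝ) else 0)) • S κ u)
        (fun ρ' w => ((if y' = y then (1 / 2 : ℝ) else 0) - (if w = y then (1 / 2 : ℝ) else 0)) • M ρ' w) ν y' := by
  rw [dM_conjV_diagK]
  simp only [blockGen_inl hLc, blockGen_zsmul_inr hr]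

/-- NOT IN PRINT; OUR BOOKKEEPING.  **AT THE COMB TABLES (α) IS ROW-PARITY-ODD, FOR ANY SYMBOL** (`trK P = −sgnK P`): one line over an1's
`SpineRecursivePureParity.parityOdd_dM_SpureRecAt_M1At` (ANY weight kernel) — the OWNER g26's W9 (b): the σ-pieces are `dM`-reads and inherit the first-order tables'
sgn-antisymmetry (`trK_SpureRecAt`, `trK_M1At`) whatever the symmetry of `G_{j+1}` or of the commutator. -/
theorem trK_rotatedVertex_comb (hLc : 1 ≤ Lc) {r : Fin (d + 1) → ℕ} (hr : r ∈ box (d + 1) Lc) (cE cVH cΛ : ℝ) (j : ℕ)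
    (g : (Fin (d + 1) → ℤ) → Fib d → ℝ) (ν : Fin (d + 1)) (y' : Fin (d + 1) → ℤ) :
    trK ((1 / 2 : ℝ) • dM (conjV (coDressKBmAt (toSite r) Lc (KInvStep (d := d) Lc (j + 1))) (diagK g)) Lc
        (SpureRecAt d Lc (toSite r) cE cVH cΛ (j + 1)) (M1At d Lc (toSite r) cΛ (j + 1)) ν y') =
      -sgnK ((1 / 2 : ℝ) • dM (conjV (coDressKBmAt (toSite r) Lc (KInvStep (d := d) Lc (j + 1))) (diagK g)) Lc
        (SpureRecAt d Lc (toSite r) cE cVH cΛ (j + 1)) (M1At d Lc (toSite r) cΛ (j + 1)) ν y') :=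
  parityOdd_smul _ (parityOdd_dM_SpureRecAt_M1At hLc hr cE cVH cΛ cΛ (j + 1) (j + 1) _ ν y')

end ClosedForm

/-! ## §4 Live charges: value forms on kernel-leg pairs, the parity swap, and the (α) audit at the comb -/

section Charges

variable {N : ℕ}

/-- [folklore] **THE LIVE CHARGE OF A CHAIN-RULE VERTEX, VALUE FORM** (the value twin of leaf-06's `DMBondCharges.hasSum_vertexOfK_legs`): through ANY kernel `K′` whose
`ℋ`-column weights decay from some centre, for a local stencil family `S`,
`HasSum ((x,z) ↦ vertexOfK K′ N S μ y x z a b) (Σ_κ Σ'_t colH K′ N μ y κ t · Σ'_{(x,z)} S κ t x z a b)` — the superposition of the stencils' OWN pair charges. -/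
theorem hasSum_prod_vertexOfK {K' : MKer (d + 1) (Fib d)} {C' m : ℝ} {c₀ : Site (d + 1)} (μ : Fin (d + 1)) (y : Site (d + 1))
    (hw : ∀ (κ : Fin (d + 1)) (t : Site (d + 1)), |colH K' N μ y κ t| ≤ C' * Real.exp (-m * l1 (t - c₀))) (hm : 0 < m)
    {S : Fin (d + 1) → Site (d + 1) → MKer (d + 1) (Fib d)} {Cs δ : ℝ} (hS : LocStencil S Cs δ) (hδ : 0 < δ) (a b : Fib d) :
    HasSum (fun xz : Site (d + 1) × Site (d + 1) => vertexOfK K' N S μ y xz.1 xz.2 a b)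
      (∑ κ : Fin (d + 1), ∑' t : Site (d + 1), colH K' N μ y κ t * ∑' xz : Site (d + 1) × Site (d + 1), S κ t xz.1 xz.2 a b) := by
  have h1 : ∀ t : Site (d + 1), ((1 : ℕ) : ℤ) • t = t := fun t => by simp
  have key : ∀ κ : Fin (d + 1), HasSum (fun xz : Site (d + 1) × Site (d + 1) =>
      ∑' t : Site (d + 1), colH K' N μ y κ t * S κ t xz.1 xz.2 a b)
      (∑' t : Site (d + 1), colH K' N μ y κ t * ∑' xz : Site (d + 1) × Site (d + 1), S κ t xz.1 xz.2 a b) := by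
    intro κ
    have hw' : ∀ t : Site (d + 1), |colH K' N μ y κ t| ≤ C' * Real.exp (-m * l1 (((1 : ℕ) : ℤ) • t - c₀)) := fun t => by
      rw [h1]; exact hw κ t
    have hQ : ∀ t : Site (d + 1), BiLoc (S κ t) (((1 : ℕ) : ℤ) • t) (((1 : ℕ) : ℤ) • t) Cs δ := fun t => by
      rw [h1]; exact hS κ t
    exact hasSum_prod_wsum (N := 1) le_rfl hw' hm hQ hδ a b
  have h := hasSum_sum (s := (Finset.univ : Finset (Fin (d + 1)))) fun κ _ => key κ
  refine h.congr_fun fun xz => ?_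
  simp only [vertexOfK, wsum]

/-- [folklore] **THE LIVE CHARGE OF A MULTIPLIER VERTEX, VALUE FORM** (no block covariance assumed; leaf-06's `hasSum_vertexOfM_legs` is the covariant collapse): through
ANY kernel `K′` whose multiplier-column weights decay (coarse scale) from some centre, for a vertex family `M`,
`HasSum ((x,z) ↦ vertexOfM K′ N M μ y x z a b) (Σ_ρ Σ'_w colM K′ N μ y ρ w · Σ'_{(x,z)} M ρ w x z a b)`. -/
theorem hasSum_prod_vertexOfM [NeZero N] {K' : MKer (d + 1) (Fib d)} {C' m : ℝ} {c₀ : Site (d + 1)} (μ : Fin (d + 1)) (y : Site (d + 1))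
    (hw : ∀ (ρ : Fin (d + 1)) (w : Site (d + 1)), |colM K' N μ y ρ w| ≤ C' * Real.exp (-m * l1 ((N : ℤ) • w - c₀))) (hm : 0 < m)
    {M : Fin (d + 1) → Site (d + 1) → MKer (d + 1) (Fib d)} {CM δ : ℝ} (hM : VertexFamily M N CM δ) (hδ : 0 < δ) (a b : Fib d) :
    HasSum (fun xz : Site (d + 1) × Site (d + 1) => vertexOfM K' N M μ y xz.1 xz.2 a b)
      (∑ ρ : Fin (d + 1), ∑' w : Site (d + 1), colM K' N μ y ρ w * ∑' xz : Site (d + 1) × Site (d + 1), M ρ w xz.1 xz.2 a b) := by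
  have hN : 1 ≤ N := Nat.one_le_iff_ne_zero.2 (NeZero.ne N)
  have key : ∀ ρ : Fin (d + 1), HasSum (fun xz : Site (d + 1) × Site (d + 1) =>
      ∑' w : Site (d + 1), colM K' N μ y ρ w * M ρ w xz.1 xz.2 a b)
      (∑' w : Site (d + 1), colM K' N μ y ρ w * ∑' xz : Site (d + 1) × Site (d + 1), M ρ w xz.1 xz.2 a b) :=
    fun ρ => hasSum_prod_wsum hN (hw ρ) hm (hM ρ) hδ a b
  have h := hasSum_sum (s := (Finset.univ : Finset (Fin (d + 1)))) fun ρ _ => key ρ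
  refine h.congr_fun fun xz => ?_
  simp only [vertexOfM, cwsum_apply]

/-- [folklore] **THE LIVE CHARGE OF an2's `dM`, VALUE FORM**: field half through the stencils' pair charges, multiplier half through the vertex family's pair charges. -/
theorem hasSum_prod_dM [NeZero N] {K' : MKer (d + 1) (Fib d)} {C' m : ℝ} {c₀ c₁ : Site (d + 1)} (μ : Fin (d + 1)) (y : Site (d + 1))
    (hw : ∀ (κ : Fin (d + 1)) (t : Site (d + 1)), |colH K' N μ y κ t| ≤ C' * Real.exp (-m * l1 (t - c₀)))
    (hw' : ∀ (ρ : Fin (d + 1)) (w : Site (d + 1)), |colM K' N μ y ρ w| ≤ C' * Real.exp (-m * l1 ((N : ℤ) • w - c₁))) (hm : 0 < m)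
    {S : Fin (d + 1) → Site (d + 1) → MKer (d + 1) (Fib d)} {Cs δ : ℝ} (hS : LocStencil S Cs δ) (hδ : 0 < δ)
    {M : Fin (d + 1) → Site (d + 1) → MKer (d + 1) (Fib d)} {CM δM : ℝ} (hM : VertexFamily M N CM δM) (hδM : 0 < δM) (a b : Fib d) :
    HasSum (fun xz : Site (d + 1) × Site (d + 1) => dM K' N S M μ y xz.1 xz.2 a b)
      ((∑ κ : Fin (d + 1), ∑' t : Site (d + 1), colH K' N μ y κ t * ∑' xz : Site (d + 1) × Site (d + 1), S κ t xz.1 xz.2 a b)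
        + ∑ ρ : Fin (d + 1), ∑' w : Site (d + 1), colM K' N μ y ρ w * ∑' xz : Site (d + 1) × Site (d + 1), M ρ w xz.1 xz.2 a b) := by
  have h := (hasSum_prod_vertexOfK μ y hw hm hS hδ a b).add (hasSum_prod_vertexOfM μ y hw' hm hM hδM a b)
  exact h.congr_fun fun xz => by rw [dM_apply]

/-- [folklore] **A PARITY-ODD KERNEL HAS A sgn-ANTISYMMETRIC PAIR-CHARGE MATRIX**: `trK P = −sgnK P` and `HasSum ((x,z) ↦ P x z a b) v` give
`HasSum ((x,z) ↦ P x z b a) (−(sgnF a·sgnF b)·v)` — antisymmetric on the field–field and multiplier–multiplier channel blocks, symmetric on the mixed ones. -/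
theorem hasSum_prod_swap_of_parityOdd {P : MKer (d + 1) (Fib d)} (hP : trK P = -sgnK P) {a b : Fib d} {v : ℝ}
    (h : HasSum (fun xz : Site (d + 1) × Site (d + 1) => P xz.1 xz.2 a b) v) :
    HasSum (fun xz : Site (d + 1) × Site (d + 1) => P xz.1 xz.2 b a) (-(sgnF a * sgnF b) * v) := by
  have e : ∀ x z : Site (d + 1), P x z b a = -(sgnF a * sgnF b) * P z x a b := fun x z => by
    have h1 := congrFun (congrFun (congrFun (congrFun hP z) x) a) b
    rw [trK_apply, Pi.neg_apply, Pi.neg_apply, Pi.neg_apply, Pi.neg_apply, sgnK_apply] at h1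
    rw [h1]; ring
  have h2 := (Equiv.prodComm (Site (d + 1)) (Site (d + 1))).hasSum_iff.2 (h.mul_left (-(sgnF a * sgnF b)))
  refine h2.congr_fun fun xz => ?_
  simp only [Function.comp_apply, Equiv.prodComm_apply, Prod.swap]
  exact e xz.1 xz.2

/-- [folklore] **… AND ZERO CHARGE IN EVERY DIAGONAL CHANNEL**: `trK P = −sgnK P`, `HasSum ((x,z) ↦ P x z a a) v` ⇒ `v = 0` (`sgnF a² = 1`). -/
theorem eq_zero_of_parityOdd_diag {P : MKer (d + 1) (Fib d)} (hP : trK P = -sgnK P) {a : Fib d} {v : ℝ}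
    (h : HasSum (fun xz : Site (d + 1) × Site (d + 1) => P xz.1 xz.2 a a) v) : v = 0 := by
  have h2 := hasSum_prod_swap_of_parityOdd hP h
  have hs : sgnF a * sgnF a = 1 := by cases a <;> simp [sgnF]
  rw [hs] at h2
  have h3 := h.unique h2
  linarith

end Charges

/-! ### The (α) audit at the comb -/

section Comb

variable {Lc : ℕ} [NeZero Lc]

/-- NOT IN PRINT; OUR BOOKKEEPING.  **THE LIVE CHARGE OF (α) AT THE COMB, PER SLOT AND CHANNEL** (the OWNER g26's W2 «per piece ONE identity-level lemma»; idea-1's (4.9)):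
for `G_{j+1} = coDressKBmAt ρ Lc (KInvStep Lc (j+1))`, `S = SpureRecAt … (j+1)`, `M = M1At … (j+1)`, the block generator `X_y` of an in-block root and every slot `(ν, y′)`,
channel `(a, b)`:  `Σ'_{(x,z)} (½ • dM (conjV G_{j+1} X_y) Lc S M ν y′) x z a b =
½·[Σ_κ Σ'_u colH G_{j+1} Lc ν y′ κ u·(½𝟙[y′=y] − ½𝟙[blk Lc u = y])·Σ'_{(x,z)} S κ u x z a b + Σ_ρ′ Σ'_w colM G_{j+1} Lc ν y′ ρ′ w·(½𝟙[y′=y] − ½𝟙[w=y])·Σ'_{(x,z)} M ρ′ w x z a b]`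
(as a `HasSum` on pairs) — (α) is CHARGE-DISPLAYED through the first-order letters' OWN pair charges, read against ONE coarse column of `G_{j+1}` with the profile
«`δ_{y′y} − 𝟙_{B(y)}`».  No value of these charges is asserted. -/
theorem hasSum_prod_rotatedVertex_comb (hLc : 1 ≤ Lc) {r : Fin (d + 1) → ℕ} (hr : r ∈ box (d + 1) Lc) (cE cVH cΛ : ℝ) (j : ℕ)
    (y : Fin (d + 1) → ℤ) (ν : Fin (d + 1)) (y' : Fin (d + 1) → ℤ) (a b : Fib d) :
    HasSum (fun xz : Site (d + 1) × Site (d + 1) =>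
        ((1 / 2 : ℝ) • dM (conjV (coDressKBmAt (toSite r) Lc (KInvStep (d := d) Lc (j + 1)))
            (diagK (((1 : ℝ) / 2) • ∑ v ∈ box (d + 1) Lc, legInd (toSite r) ((Lc : ℤ) • y + toSite v)))) Lc
          (SpureRecAt d Lc (toSite r) cE cVH cΛ (j + 1)) (M1At d Lc (toSite r) cΛ (j + 1)) ν y') xz.1 xz.2 a b)
      ((1 / 2 : ℝ) *
        ((∑ κ : Fin (d + 1), ∑' u : Site (d + 1),
            colH (coDressKBmAt (toSite r) Lc (KInvStep (d := d) Lc (j + 1))) Lc ν y' κ u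
              * ((if y' = y then (1 / 2 : ℝ) else 0) - (if blk Lc u = y then (1 / 2 : ℝ) else 0))
              * ∑' xz : Site (d + 1) × Site (d + 1), SpureRecAt d Lc (toSite r) cE cVH cΛ (j + 1) κ u xz.1 xz.2 a b)
          + ∑ ρ' : Fin (d + 1), ∑' w : Site (d + 1),
            colM (coDressKBmAt (toSite r) Lc (KInvStep (d := d) Lc (j + 1))) Lc ν y' ρ' w
              * ((if y' = y then (1 / 2 : ℝ) else 0) - (if w = y then (1 / 2 : ℝ) else 0))
              * ∑' xz : Site (d + 1) × Site (d + 1), M1At d Lc (toSite r) cΛ (j + 1) ρ' w xz.1 xz.2 a b)) := by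
  -- the commutator kernel decays (bounded symbol), so both column families decay from the slot
  obtain ⟨δG, CG, hδG, hCG, hG⟩ := decays_coDressKBmAt_KInvStep (d := d) hr (j + 1)
  have hg : ∀ p c, |(((1 : ℝ) / 2) • ∑ v ∈ box (d + 1) Lc, legInd (toSite r) ((Lc : ℤ) • y + toSite v)) p c| ≤
      |((1 : ℝ) / 2)| * (box (d + 1) Lc).card := fun p c => abs_blockGen_le Lc (toSite r) _ y p c
  have hK := decays_conjV_diagK hG hg
  obtain ⟨Cs, δs, hδs, hS⟩ := locStencil_SpureRecAt (d := d) (Lc := Lc) hLc hr cE cVH cΛ (j + 1)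
  have hM := vertexFamily_M1At (d := d) hLc hr cΛ (j + 1) (zero_le_one)
  have h := (hasSum_prod_dM (c₀ := (Lc : ℤ) • y') (c₁ := (Lc : ℤ) • y') ν y' (fun κ t => abs_colH_le (N := Lc) hK ν y' κ t)
    (fun ρ w => abs_colM_le (N := Lc) hK ν y' ρ w) hδG hS hδs hM one_pos a b).mul_left (1 / 2 : ℝ)
  -- evaluate the commutator's columns: ONE coarse column of `G` times the profile
  simp only [colH_conjV_diagK, colM_conjV_diagK, blockGen_inl hLc, blockGen_zsmul_inr hr] at h
  refine h.congr_fun fun xz => ?_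
  simp only [Pi.smul_apply, smul_eq_mul]

/-- NOT IN PRINT; OUR BOOKKEEPING.  **THE (α) CHARGE MATRIX IS sgn-ANTISYMMETRIC, POINTWISE IN THE SLOT** (the OWNER g26's W10 «read-out lemma wanted for (α)»):
if `v` is the `(a,b)` pair charge of (α) at slot `(ν,y′)` then `−(sgnF a·sgnF b)·v` is its `(b,a)` pair charge — from the comb tables' row parity
(`trK_SpureRecAt`, `trK_M1At`), NO symmetry of `G_{j+1}` used.  On the field–field block: plain antisymmetry `Z^{βα} = −Z^{αβ}`. -/
theorem hasSum_prod_rotatedVertex_comb_swap (hLc : 1 ≤ Lc) {r : Fin (d + 1) → ℕ} (hr : r ∈ box (d + 1) Lc) (cE cVH cΛ : ℝ) (j : ℕ)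
    (g : (Fin (d + 1) → ℤ) → Fib d → ℝ) (ν : Fin (d + 1)) (y' : Fin (d + 1) → ℤ) {a b : Fib d} {v : ℝ}
    (h : HasSum (fun xz : Site (d + 1) × Site (d + 1) =>
        ((1 / 2 : ℝ) • dM (conjV (coDressKBmAt (toSite r) Lc (KInvStep (d := d) Lc (j + 1))) (diagK g)) Lc
          (SpureRecAt d Lc (toSite r) cE cVH cΛ (j + 1)) (M1At d Lc (toSite r) cΛ (j + 1)) ν y') xz.1 xz.2 a b) v) :
    HasSum (fun xz : Site (d + 1) × Site (d + 1) =>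
        ((1 / 2 : ℝ) • dM (conjV (coDressKBmAt (toSite r) Lc (KInvStep (d := d) Lc (j + 1))) (diagK g)) Lc
          (SpureRecAt d Lc (toSite r) cE cVH cΛ (j + 1)) (M1At d Lc (toSite r) cΛ (j + 1)) ν y') xz.1 xz.2 b a) (-(sgnF a * sgnF b) * v) :=
  hasSum_prod_swap_of_parityOdd (trK_rotatedVertex_comb hLc hr cE cVH cΛ j g ν y') h

/-- NOT IN PRINT; OUR BOOKKEEPING.  **EVERY DIAGONAL CHANNEL OF (α) IS CHARGE-FREE, POINTWISE IN THE SLOT**: the `(a,a)` pair charge of (α) at every slot `(ν,y′)` is `0`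
(parity; the pair family is summable by `hasSum_prod_rotatedVertex_comb`). -/
theorem hasSum_prod_rotatedVertex_comb_diag (hLc : 1 ≤ Lc) {r : Fin (d + 1) → ℕ} (hr : r ∈ box (d + 1) Lc) (cE cVH cΛ : ℝ) (j : ℕ)
    (y : Fin (d + 1) → ℤ) (ν : Fin (d + 1)) (y' : Fin (d + 1) → ℤ) (a : Fib d) :
    HasSum (fun xz : Site (d + 1) × Site (d + 1) =>
        ((1 / 2 : ℝ) • dM (conjV (coDressKBmAt (toSite r) Lc (KInvStep (d := d) Lc (j + 1)))
            (diagK (((1 : ℝ) / 2) • ∑ v ∈ box (d + 1) Lc, legInd (toSite r) ((Lc : ℤ) • y + toSite v)))) Lc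
          (SpureRecAt d Lc (toSite r) cE cVH cΛ (j + 1)) (M1At d Lc (toSite r) cΛ (j + 1)) ν y') xz.1 xz.2 a a) 0 := by
  have h := hasSum_prod_rotatedVertex_comb hLc hr cE cVH cΛ j y ν y' a a
  have h0 := eq_zero_of_parityOdd_diag (trK_rotatedVertex_comb hLc hr cE cVH cΛ j _ ν y') h
  rwa [h0] at h

/-- NOT IN PRINT; OUR BOOKKEEPING.  **THE BRANCH-(S) TEST FOR (α), PER CHANNEL**: if the comb S-slot letters and the mixed letters are CHARGE-FREE in the channel `(a,b)`
(`Σ'_{(x,z)} S_{j+1} κ u x z a b = 0` for all `κ u`, `Σ'_{(x,z)} M1_{j+1} ρ′ w x z a b = 0` for all `ρ′ w`), then (α) has ZERO live charge in that channel at EVERY slot.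
(Hypotheses displayed, not asserted: for the comb S-slot the field–field pair charge is a two-face sum of the previous member's vertex,
`CubicPushFaceCharge.hasSum_prod_SpureRecAt_succ_inl_inl`; on the engine it vanishes at j = 0, 1 — E15 PART C, leaf-04 g61 R-1.) -/
theorem hasSum_prod_rotatedVertex_comb_zero (hLc : 1 ≤ Lc) {r : Fin (d + 1) → ℕ} (hr : r ∈ box (d + 1) Lc) (cE cVH cΛ : ℝ) (j : ℕ)
    (y : Fin (d + 1) → ℤ) (ν : Fin (d + 1)) (y' : Fin (d + 1) → ℤ) {a b : Fib d}
    (hS0 : ∀ (κ : Fin (d + 1)) (u : Site (d + 1)),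
      ∑' xz : Site (d + 1) × Site (d + 1), SpureRecAt d Lc (toSite r) cE cVH cΛ (j + 1) κ u xz.1 xz.2 a b = 0)
    (hM0 : ∀ (ρ' : Fin (d + 1)) (w : Site (d + 1)),
      ∑' xz : Site (d + 1) × Site (d + 1), M1At d Lc (toSite r) cΛ (j + 1) ρ' w xz.1 xz.2 a b = 0) :
    HasSum (fun xz : Site (d + 1) × Site (d + 1) =>
        ((1 / 2 : ℝ) • dM (conjV (coDressKBmAt (toSite r) Lc (KInvStep (d := d) Lc (j + 1)))
            (diagK (((1 : ℝ) / 2) • ∑ v ∈ box (d + 1) Lc, legInd (toSite r) ((Lc : ℤ) • y + toSite v)))) Lc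
          (SpureRecAt d Lc (toSite r) cE cVH cΛ (j + 1)) (M1At d Lc (toSite r) cΛ (j + 1)) ν y') xz.1 xz.2 a b) 0 := by
  have h := hasSum_prod_rotatedVertex_comb hLc hr cE cVH cΛ j y ν y' a b
  simp only [hS0, hM0, mul_zero, tsum_zero, Finset.sum_const_zero, add_zero] at h
  exact h

end Comb

end Summit.QuantumFields.BalabanUV.Beta.GAN24.WardResidualRotatedVertex

end
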